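import Literature.MathematicalPhysics.QuantumFieldTheory.QCDOS
import Literature.MathematicalPhysics.QuantumFieldTheory.ConstructiveQFTWave0OddRPProofs
import Literature.MathematicalPhysics.QuantumLattice.AdaptiveCoarseSystem

/-!
Sketch for crux-ideate stmt-QuantumFields-9495 (`AdaptiveBlockFermions.CollarModeTail`), ideator 3.
First lemmas of the three idea cards (Ideas/*.md). Nothing here is proved; every `def … : Prop`
must only ELABORATE over existing declarations. Units: tree action `∑ₚ (3 − Re tr U_p)`,
`β = 2/g₀²` (the parameter of `wilsonMeasure`).
-/

open MeasureTheory
open scoped Matrix ComplexConjugate BigOperators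
open Literature.MathematicalPhysics.QuantumFieldTheory
open Literature.MathematicalPhysics.QuantumLattice
open Literature.Probability.LatticeModels

namespace Summit.QuantumFields.QCD.Cruxes.CollarModeTail.Sketch

/-- The gauge group of the crux. -/
abbrev SU3 : Type := Matrix.specialUnitaryGroup (Fin 3) ℂ

/-- Its fundamental representation (the `ρ` fed to `wilsonMeasure` / `wilsonDirac` in the crux). -/
noncomputable abbrev ρ₃ : SU3 →* Matrix (Fin 3) (Fin 3) ℂ := fundamentalRep (Fin 3)

/-- Local Wilson action (tree units) of the plaquettes based in the one-sided box `x + [0,R)^4`. -/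
noncomputable def boxAction {L : ℕ} [NeZero L] (R : ℕ) (x : Site 4 L) (U : GaugeConfig 4 L SU3) : ℝ :=
  ∑ p ∈ Finset.univ.filter (fun p : Plaquette 4 L => ∀ i, (p.1 i - x i).val < R),
    ((3 : ℝ) - (ρ₃ (plaquetteHolonomy U p.1 p.2.1.1 p.2.1.2)).trace.re)

/-! ## Card `tilted-odd-chessboard` (measure side) -/

/-- First lemma (a), provable now from `wilsonExpectation_oddReflectionPositive` +
reflection invariance of the Wilson measure: the RP DOUBLING STEP on the odd torus. -/
def OddDoubling : Prop :=
  ∀ (L : ℕ) [NeZero L], Odd L → 3 ≤ L → ∀ β : ℝ, 0 ≤ β →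
    ∀ F : GaugeConfig 4 L SU3 → ℝ, Measurable F → (∃ C : ℝ, ∀ U, |F U| ≤ C) → (∀ U, 0 ≤ F U) →
      DependsOn F ((WilsonOddRP.oPosEdges ∪ WilsonOddRP.oSharedEdges : Finset (Edge 4 L)) :
        Set (Edge 4 L)) →
        (∫ U, F U ∂(wilsonMeasure (d := 4) (L := L) ρ₃ β)) ^ 2 ≤
          ∫ U, F (GaugeConfig.timeReflect U) * F U ∂(wilsonMeasure (d := 4) (L := L) ρ₃ β)

/-- First lemma (b), the load-bearing measure statement of the card: TILTED CELL MOMENTS are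
bounded uniformly in the (odd) volume, in `β ≥ β₀`, and MULTIPLICATIVELY in the number of
`2R`-separated cells — the chessboard/Chatterjee output that feeds exponential moments. -/
def CellTiltBound : Prop :=
  ∀ θ : ℝ, 0 < θ → θ < 1 → ∀ R : ℕ, ∃ C β₀ : ℝ, ∃ L₀ : ℕ, ∀ (L : ℕ) [NeZero L], Odd L → L₀ ≤ L →
    ∀ β : ℝ, β₀ ≤ β → ∀ (n : ℕ) (xs : Fin n → Site 4 L),
      (∀ a b, a ≠ b → ∃ i, 2 * R ≤ min (xs a i - xs b i).val (xs b i - xs a i).val) →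
        ∫ U, Real.exp (θ * β * ∑ a, boxAction R (xs a) U) ∂(wilsonMeasure (d := 4) (L := L) ρ₃ β)
          ≤ C ^ n

/-- Consequence (exponential Chebyshev): sharp-exponent local large deviations for concentrated
action, uniform in the volume — the probabilistic half of the dislocation bound. -/
def LocalActionLD : Prop :=
  ∀ θ : ℝ, 0 < θ → θ < 1 → ∀ R : ℕ, ∃ C β₀ : ℝ, ∃ L₀ : ℕ, ∀ (L : ℕ) [NeZero L], Odd L → L₀ ≤ L →
    ∀ β : ℝ, β₀ ≤ β → ∀ (A : ℝ) (x : Site 4 L),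
      (wilsonMeasure (d := 4) (L := L) ρ₃ β) {U | A ≤ boxAction R x U}
        ≤ ENNReal.ofReal (C * Real.exp (-(θ * β * A)))

/-! ## Card `schur-cluster-certificate` (lattice-scale deterministic side) -/

/-- First lemma (a), provable now (Berruto–Narayanan–Neuberger 2000 §2, as linear algebra): a
perturbation `Lp` supported on the rows of a cluster `S` creates a kernel vector of `D₀ + Lp`
iff the small cluster matrix `R_S = (1 + Lp D₀⁻¹)|_{S×S}` is singular. -/
def SchurClusterReduction : Prop :=
  ∀ (ι : Type) [Fintype ι] [DecidableEq ι] (D₀ Lp : Matrix ι ι ℂ) (S : ι → Prop) [DecidablePred S],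
    IsUnit D₀ → (∀ i, ¬ S i → ∀ j, Lp i j = 0) →
      ((∃ v : ι → ℂ, v ≠ 0 ∧ (D₀ + Lp) *ᵥ v = 0) ↔
        ∃ w : {i // S i} → ℂ, w ≠ 0 ∧ ((1 + Lp * D₀⁻¹).toBlock S S) *ᵥ w = 0)

/-- First lemma (b), the load-bearing deterministic conjecture the certificate must establish
(window form of the dislocation threshold, `3/(4 b₀(0)) = 12π²/11` tree units): on every large
torus, a gauge field whose massless Wilson–Dirac operator has a REAL eigenvalue in `(0, 1]`
carries total plaquette action strictly above `12π²/11`. (Per-volume form: replace by `16π²/11`.) -/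
def RealEigenvalueActionGap : Prop :=
  ∃ δ : ℝ, 0 < δ ∧ ∃ L₀ : ℕ, ∀ (L : ℕ) [NeZero L], L₀ ≤ L → ∀ (U : GaugeConfig 4 L SU3) (ev : ℝ),
    0 < ev → ev ≤ 1 →
      (∃ v : (TorusSite 4 L × Fin 3 × Fin 4) → ℂ, v ≠ 0 ∧ wilsonDirac ρ₃ U 0 1 *ᵥ v = (ev : ℂ) • v) →
        12 * Real.pi ^ 2 / 11 + δ ≤ wilsonAction ρ₃ U

/-- The pseudospectral (robust, certifiable) form actually needed at threshold `c₀/b = η > 0`: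
small `σ_min(D_W(U,0) − ev)` already forces the action gap, uniformly for `η ≤ η₀`. -/
def RealPseudospectrumActionGap : Prop :=
  ∃ δ η₀ : ℝ, 0 < δ ∧ 0 < η₀ ∧ ∃ L₀ : ℕ, ∀ (L : ℕ) [NeZero L], L₀ ≤ L →
    ∀ (U : GaugeConfig 4 L SU3) (ev : ℝ), η₀ ≤ ev → ev ≤ 1 →
      (∃ v : (TorusSite 4 L × Fin 3 × Fin 4) → ℂ,
        (star v ⬝ᵥ v).re = 1 ∧
          (star ((wilsonDirac ρ₃ U 0 1 - (ev : ℂ) • 1) *ᵥ v) ⬝ᵥ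
            ((wilsonDirac ρ₃ U 0 1 - (ev : ℂ) • 1) *ᵥ v)).re ≤ η₀ ^ 2) →
        12 * Real.pi ^ 2 / 11 + δ ≤ wilsonAction ρ₃ U

/-! ## Card `level-velocity-window` (the `c₀/b` window as a Wegner factor; boundary strata) -/

/-- First lemma (a), provable now: the crux's count is a count of eigenvalues of the HERMITIAN
collar family `H_c(m) = Γ₅|_c · D_c(m)` in the window `(−c₀/b, c₀/b)` — the object whose Kato
spectral flow in `m` the card organises (crossings = real eigenvalues of `D_c(0)`; the Dirichlet
truncation contributes gapless surface branches for `−2 < m < 0`). Stated for any index set. -/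
def HermitianCollarCount : Prop :=
  ∀ (ι : Type) [Fintype ι] [DecidableEq ι] (D Γ : Matrix ι ι ℂ) (c : ι → Prop) [DecidablePred c]
    (t : ℝ), Γᴴ = Γ → Γ * Γ = 1 → Γ * D * Γ = Dᴴ → (∀ i j, c i → ¬ c j → Γ i j = 0) → 0 ≤ t →
      ∃ hH : ((Γ * D).toBlock c c).IsHermitian,
        Fintype.card {i // (Matrix.isHermitian_conjTranspose_mul_self (D.toBlock c c)).eigenvalues i
            < t ^ 2} = Fintype.card {i // |hH.eigenvalues i| < t}

/-- First lemma (b): Kato slope bound — eigenvalue branches of `m ↦ H_c(m)` are 1-Lipschitz in the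
mass (Weyl's inequality for the Hermitian perturbation `Γ|_c · (m' − m)`), so the window count at
`m` controls and is controlled by counts at nearby masses; stated as Weyl monotonicity of sorted
eigenvalues under a perturbation of operator norm `≤ |m' − m|`. -/
def MassLipschitz : Prop :=
  ∀ (L : ℕ) [NeZero L] (U : GaugeConfig 4 L SU3) (c : (TorusSite 4 L × Fin 3 × Fin 4) → Prop)
    [DecidablePred c] (m m' : ℝ),
    let Γ := spinorLift (L := L) (N := 3) gammaFive
    let H : ℝ → Matrix {p // c p} {p // c p} ℂ := fun μ => (Γ * wilsonDirac ρ₃ U μ 1).toBlock c c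
    ∀ (h : (H m).IsHermitian) (h' : (H m').IsHermitian) (i : {p // c p}),
      |h.eigenvalues i - h'.eigenvalues i| ≤ |m - m'|


/-- First lemma (c), provable now (elementary real analysis, Darboux + monotonicity): the LEVEL-
VELOCITY WINDOW BOUND. A differentiable branch `f` (an eigenvalue of `H_c(m; U·e^{φT})` along a Haar
one-parameter link rotation) whose speed is at least `v₀` whenever it is inside the strip
`|f| < η₀` spends Lebesgue measure at most `(2η/v₀)·(2 + (b−a)V₁/(2η₀))` inside the window
`|f| < η ≤ η₀`: the window `(c₀/b)²` of the crux becomes a factor `η = c₀/b` in expectation. -/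
def LevelVelocityWindow : Prop :=
  ∀ (f : ℝ → ℝ) (a b v₀ V₁ η₀ η : ℝ), a ≤ b → 0 < v₀ → 0 ≤ V₁ → 0 < η₀ → 0 < η → η ≤ η₀ →
    (∀ x ∈ Set.Icc a b, DifferentiableAt ℝ f x) → (∀ x ∈ Set.Icc a b, |deriv f x| ≤ V₁) →
      (∀ x ∈ Set.Icc a b, |f x| < η₀ → v₀ ≤ |deriv f x|) →
        volume {x ∈ Set.Icc a b | |f x| < η} ≤
          ENNReal.ofReal ((2 * η / v₀) * (2 + (b - a) * V₁ / (2 * η₀)))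

/-! (The route file is deliberately not imported: nothing here needs the crux decl, and the sketch
must elaborate independently of the route's rebuilds.) -/

end Summit.QuantumFields.QCD.Cruxes.CollarModeTail.Sketch
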